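import Mathlib
import Summits.Ventures.HodgeRepro.GaussSumStability

/-!
# GaussSumProductLocal — `𝔤(χ) 𝔤(χ⁻¹) = χ(−1) · |R|` on a finite LOCAL ring: the local sign is `±1` at EVERY conductor

Blind re-derivation cell `pub-hodge-repro`, seat night-2 (gen 3).  Target tree path
`lean/Summits/Ventures/HodgeRepro/GaussSumProductLocal.lean`.  Continues `GaussSumStability.lean` (gen 1: `PsiAnn`,
`sum_psi_mul`, `gaussSum_eq_sum_units`, `sum_units_mul_right`); the same identity at conductor `1`, where `R = 𝒪/𝔭`
is a field and Mathlib's `gaussSum_mul_gaussSum_eq_card` applies, is `OcticCMPointTameSign.lean` (gen 3).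

**The identity.**  Let `R = 𝒪/𝔭^c` (`c ≥ 2`) be modelled by a finite commutative ring with an ideal `𝔪` such that the
non-units are exactly `𝔪` (a finite local ring), `ψ` a primitive additive character, `A := PsiAnn ψ 𝔪` its
`ψ`-annihilator (`= 𝔭^{c−1}/𝔭^c`: the elements `t` with `ψ(t 𝔪) = 1`), with `A ⊆ 𝔪` and `A · A = 0` (both say `c ≥ 2`).
For a multiplicative character `χ` PRIMITIVE in the sense that it is non-trivial on `1 + A` (conductor exactly `c`):

`gaussSum χ ψ · gaussSum χ⁻¹ ψ = χ(−1) · |R|`  (`gaussSum_mul_gaussSum_inv_eq_card`).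

Proof (Kudla's computation behind (3.29)/(3.32), on the kernel): expand both sums over the units, substitute `x = u y`,
use `ψ(x + y) = ψ((u + 1) y)` and sum over `y ∈ R^×` first — `∑_{y ∈ R^×} ψ(t y) = |R|·[t = 0] − |𝔪|·[t ∈ A]`
(`sum_units_psi`: the sum over all of `R` is `|R|·[t = 0]` by primitivity, Mathlib `AddChar.sum_mulShift`; the sum over
`𝔪` is `|𝔪|·[t ∈ A]`, gen 1's `sum_psi_mul`); the first term leaves `u = −1`, the second is `|𝔪| ∑_{u + 1 ∈ A} χ(u)`,
which vanishes because `u ↦ u + 1` identifies these units with `A` (`A ⊆ 𝔪` makes `−1 + A` units) and the character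
sum `∑_{z ∈ A} χ(1 − z)` of a character non-trivial on the group `1 + A` is `0` (shift by one `w ∈ A` with
`χ(1 − w) ≠ 1`, using `A · A = 0`: `(z − 1)(1 − w) = (z + w) − 1`).

**Consequences for (E2)** (in `OcticCMPointDeepSign.lean`, which imports this file and `OcticCMPointTameSign.lean`):
on gen 1's model `LocalChar R`, `eps` (Kudla Prop 3.8 (ii) / (3.32) p0109), `ε(ω) ε(ω⁻¹) = κ² ω(−1) |R|` for a primitive
`ω`, and with the `s = ½` normalisation and the conjugate-duality identity of ROUTE-B §9.9 (f), `ε(½, ω) = ±1` — at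
EVERY conductor, not only the tame one.

**What this is not.**  The model hypotheses (`hloc`, `A ⊆ 𝔪`, `A · A = 0`, primitivity of `ψ` and `χ`) transcribe
`𝒪/𝔭^c`, `c ≥ 2`, with a character of conductor exactly `c`; they are not derived from a valuation-ring structure here.
The four `χ′_j` are on no page.  Nothing here says anything about the status of the Hodge conjecture for CM abelian
varieties, which is NOT proved.
-/

set_option autoImplicit false

noncomputable section

open Finset Classical

namespace Summit.Ventures.HodgeRepro.GaussSumStability

variable {R : Type} [CommRing R]

/-- The `ψ`-annihilator of an ideal contains `0`. -/
theorem PsiAnn.zero (ψ : AddChar R ℂ) (I : Ideal R) : PsiAnn ψ I 0 := by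
  intro z _
  rw [zero_mul, AddChar.map_zero_eq_one]

/-- The `ψ`-annihilator of an ideal is closed under addition. -/
theorem PsiAnn.add {ψ : AddChar R ℂ} {I : Ideal R} {x y : R} (hx : PsiAnn ψ I x) (hy : PsiAnn ψ I y) :
    PsiAnn ψ I (x + y) := by
  intro z hz
  rw [add_mul, AddChar.map_add_eq_mul, hx z hz, hy z hz, mul_one]

/-- The `ψ`-annihilator of an ideal is closed under negation. -/
theorem PsiAnn.neg {ψ : AddChar R ℂ} {I : Ideal R} {x : R} (hx : PsiAnn ψ I x) : PsiAnn ψ I (-x) := by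
  have h := hx.mul_left (-1)
  rwa [neg_one_mul] at h

/-- `x + w ∈ A ↔ x ∈ A` for `w ∈ A`. -/
theorem PsiAnn.add_iff {ψ : AddChar R ℂ} {I : Ideal R} {w : R} (hw : PsiAnn ψ I w) (x : R) :
    PsiAnn ψ I (x + w) ↔ PsiAnn ψ I x := by
  constructor
  · intro h
    have h' := h.add hw.neg
    rwa [add_neg_cancel_right] at h'
  · exact fun h => h.add hw

variable [Fintype R]

/-- A sum over the units is the sum over the ring of the function cut off outside the units. -/
theorem sum_units_eq (F : R → ℂ) : ∑ y : Rˣ, F y = ∑ x : R, if IsUnit x then F x else 0 := by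
  rw [← sum_subset (subset_univ (univ.image (fun y : Rˣ => (y : R))))]
  · rw [sum_image (fun x _ y _ h => Units.ext h)]
    exact sum_congr rfl fun y _ => (if_pos y.isUnit).symm
  · intro x _ hx
    rw [if_neg]
    intro hu
    apply hx
    simp only [mem_image, mem_univ, true_and]
    exact ⟨hu.unit, rfl⟩

/-- The sum over an ideal (as a subtype) is the sum over the ring cut off outside the ideal. -/
theorem sum_ideal_eq (I : Ideal R) (F : R → ℂ) : ∑ z : I, F z = ∑ x : R, if x ∈ I then F x else 0 := by
  rw [← sum_filter]
  exact (sum_subtype (univ.filter (· ∈ I)) (fun x => by simp only [mem_filter, mem_univ, true_and]) F).symm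

/-- **The sum of `ψ(t y)` over the units of a finite local ring**: `|R| · [t = 0] − |𝔪| · [t ∈ A]`, `A` the
`ψ`-annihilator of the maximal ideal `𝔪` (`hloc`: the non-units are exactly `𝔪`; `hψ`: `ψ` primitive). -/
theorem sum_units_psi (ψ : AddChar R ℂ) (hψ : ψ.IsPrimitive) (𝔪 : Ideal R)
    (hloc : ∀ x : R, x ∈ 𝔪 ↔ ¬ IsUnit x) (t : R) :
    ∑ y : Rˣ, ψ (t * y) =
      (if t = 0 then (Fintype.card R : ℂ) else 0) - (if PsiAnn ψ 𝔪 t then (Fintype.card 𝔪 : ℂ) else 0) := by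
  have hall : ∑ x : R, ψ (t * x) = if t = 0 then (Fintype.card R : ℂ) else 0 := by
    have h := AddChar.sum_mulShift t hψ
    simp only [mul_comm] at h
    exact_mod_cast h
  have hI : ∑ z : 𝔪, ψ (t * (z : R)) = if PsiAnn ψ 𝔪 t then (Fintype.card 𝔪 : ℂ) else 0 := sum_psi_mul ψ 𝔪 t
  have hsplit : ∑ x : R, ψ (t * x) = (∑ y : Rˣ, ψ (t * y)) + ∑ z : 𝔪, ψ (t * (z : R)) := by
    rw [sum_units_eq (fun x => ψ (t * x)), sum_ideal_eq 𝔪 (fun x => ψ (t * x)), ← sum_add_distrib]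
    refine sum_congr rfl fun x _ => ?_
    by_cases hx : IsUnit x
    · rw [if_pos hx, if_neg (fun h => (hloc x).mp h hx), add_zero]
    · rw [if_neg hx, if_pos ((hloc x).mpr hx), zero_add]
  rw [← hall, ← hI, hsplit, add_sub_cancel_right]

/-- **The character sum over `−1 + A` vanishes** for `χ` non-trivial on `1 + A`, when `A ⊆ 𝔪` and `A · A = 0`:
`∑_{u ∈ R^×, u + 1 ∈ A} χ(u) = 0`. -/
theorem sum_units_psiAnn_eq_zero (ψ : AddChar R ℂ) (𝔪 : Ideal R) (hloc : ∀ x : R, x ∈ 𝔪 ↔ ¬ IsUnit x)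
    (hA : ∀ t, PsiAnn ψ 𝔪 t → t ∈ 𝔪) (hsq : ∀ t t', PsiAnn ψ 𝔪 t → PsiAnn ψ 𝔪 t' → t * t' = 0)
    (χ : MulChar R ℂ) (hprim : ∃ z₀, PsiAnn ψ 𝔪 z₀ ∧ χ (1 + z₀) ≠ 1) :
    ∑ u : Rˣ, (if PsiAnn ψ 𝔪 ((u : R) + 1) then χ u else 0) = 0 := by
  -- every `x` with `x + 1 ∈ A` is a unit
  have hunit : ∀ x : R, PsiAnn ψ 𝔪 (x + 1) → IsUnit x := by
    intro x hx
    by_contra hu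
    have h1 : x ∈ 𝔪 := (hloc x).mpr hu
    have h2 : x + 1 ∈ 𝔪 := hA _ hx
    have h3 : (1 : R) ∈ 𝔪 := by
      have := 𝔪.sub_mem h2 h1
      rwa [add_sub_cancel_left] at this
    exact (hloc 1).mp h3 isUnit_one
  -- the sum as a sum over `R`, then over `z = x + 1 ∈ A`
  have e1 : ∑ u : Rˣ, (if PsiAnn ψ 𝔪 ((u : R) + 1) then χ u else 0) =
      ∑ x : R, (if PsiAnn ψ 𝔪 (x + 1) then χ x else 0) := by
    rw [sum_units_eq (fun x => if PsiAnn ψ 𝔪 (x + 1) then χ x else 0)]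
    refine sum_congr rfl fun x _ => ?_
    by_cases hx : PsiAnn ψ 𝔪 (x + 1)
    · rw [if_pos (hunit x hx)]
    · rw [if_neg hx, ite_self]
  have e2 : ∑ x : R, (if PsiAnn ψ 𝔪 (x + 1) then χ x else 0) =
      ∑ z : R, (if PsiAnn ψ 𝔪 z then χ (z - 1) else 0) := by
    refine Fintype.sum_equiv (Equiv.addRight (1 : R)) _ _ fun x => ?_
    simp only [Equiv.coe_addRight, add_sub_cancel_right]
  rw [e1, e2]
  -- the shift by `w = −z₀ ∈ A`
  obtain ⟨z₀, hz₀, hχ₀⟩ := hprim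
  set T := ∑ z : R, (if PsiAnn ψ 𝔪 z then χ (z - 1) else 0) with hT
  have hw : PsiAnn ψ 𝔪 (-z₀) := hz₀.neg
  have hshift : T = χ (1 + z₀) * T := by
    have e3 : T = ∑ z : R, (if PsiAnn ψ 𝔪 (z + -z₀) then χ (z + -z₀ - 1) else 0) := by
      rw [hT]
      exact (Fintype.sum_equiv (Equiv.addRight (-z₀)) _ _ fun z => rfl).symm
    conv_lhs => rw [e3]
    rw [hT, mul_sum]
    refine sum_congr rfl fun z _ => ?_
    rw [PsiAnn.add_iff hw]
    by_cases hz : PsiAnn ψ 𝔪 z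
    · rw [if_pos hz, if_pos hz, ← map_mul]
      congr 1
      have := hsq z z₀ hz hz₀
      linear_combination -this
    · rw [if_neg hz, if_neg hz, mul_zero]
  have hne : (1 : ℂ) - χ (1 + z₀) ≠ 0 := sub_ne_zero.mpr (Ne.symm hχ₀)
  have h0 : (1 - χ (1 + z₀)) * T = 0 := by
    rw [sub_mul, one_mul, ← hshift, sub_self]
  exact (mul_eq_zero.mp h0).resolve_left hne

/-- **The product formula on a finite local ring**: `gaussSum χ ψ · gaussSum χ⁻¹ ψ = χ(−1) · |R|` for a primitive
`ψ` and a `χ` non-trivial on `1 + A`, `A` the `ψ`-annihilator of the maximal ideal (`A ⊆ 𝔪`, `A · A = 0`). -/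
theorem gaussSum_mul_gaussSum_inv_eq_card (ψ : AddChar R ℂ) (hψ : ψ.IsPrimitive) (𝔪 : Ideal R)
    (hloc : ∀ x : R, x ∈ 𝔪 ↔ ¬ IsUnit x) (hA : ∀ t, PsiAnn ψ 𝔪 t → t ∈ 𝔪)
    (hsq : ∀ t t', PsiAnn ψ 𝔪 t → PsiAnn ψ 𝔪 t' → t * t' = 0) (χ : MulChar R ℂ)
    (hprim : ∃ z₀, PsiAnn ψ 𝔪 z₀ ∧ χ (1 + z₀) ≠ 1) :
    gaussSum χ ψ * gaussSum χ⁻¹ ψ = χ (-1) * (Fintype.card R : ℂ) := by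
  -- `χ(u y) χ⁻¹(y) = χ(u)` for units
  have hχ : ∀ (u y : Rˣ), χ ((u : R) * y) * χ⁻¹ y = χ u := by
    intro u y
    have hy : χ (y : R) ≠ 0 := by
      intro h0
      have h1 : χ (y : R) * χ ((y⁻¹ : Rˣ) : R) = 1 := by
        rw [← map_mul, Units.mul_inv, MulChar.map_one]
      rw [h0, zero_mul] at h1
      exact zero_ne_one h1
    rw [MulChar.inv_apply_eq_inv', map_mul, mul_assoc, mul_inv_cancel₀ hy, mul_one]
  calc gaussSum χ ψ * gaussSum χ⁻¹ ψ
      = ∑ y : Rˣ, ∑ x : Rˣ, χ x * χ⁻¹ y * ψ (x + y) := by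
        rw [gaussSum_eq_sum_units, gaussSum_eq_sum_units, sum_mul_sum, sum_comm]
        refine sum_congr rfl fun y _ => sum_congr rfl fun x _ => ?_
        rw [AddChar.map_add_eq_mul]
        ring
    _ = ∑ y : Rˣ, ∑ u : Rˣ, χ u * ψ (((u : R) + 1) * y) := by
        refine sum_congr rfl fun y _ => ?_
        rw [← sum_units_mul_right (fun x : Rˣ => χ x * χ⁻¹ y * ψ (x + y)) y]
        refine sum_congr rfl fun u _ => ?_
        simp only [Units.val_mul]
        rw [hχ u y, add_mul, one_mul]
    _ = ∑ u : Rˣ, χ u * ∑ y : Rˣ, ψ (((u : R) + 1) * y) := by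
        rw [sum_comm]
        exact sum_congr rfl fun u _ => (mul_sum _ _ _).symm
    _ = ∑ u : Rˣ, χ u * ((if (u : R) + 1 = 0 then (Fintype.card R : ℂ) else 0)
          - (if PsiAnn ψ 𝔪 ((u : R) + 1) then (Fintype.card 𝔪 : ℂ) else 0)) := by
        refine sum_congr rfl fun u _ => ?_
        rw [sum_units_psi ψ hψ 𝔪 hloc]
    _ = (∑ u : Rˣ, (if u = -1 then χ u * (Fintype.card R : ℂ) else 0))
          - (Fintype.card 𝔪 : ℂ) * ∑ u : Rˣ, (if PsiAnn ψ 𝔪 ((u : R) + 1) then χ u else 0) := by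
        rw [mul_sum, ← sum_sub_distrib]
        refine sum_congr rfl fun u _ => ?_
        have hu : ((u : R) + 1 = 0) ↔ (u = -1) := by
          constructor
          · intro h
            apply Units.ext
            rw [Units.val_neg, Units.val_one]
            exact eq_neg_of_add_eq_zero_left h
          · intro h
            rw [h, Units.val_neg, Units.val_one, neg_add_cancel]
        simp only [hu]
        split_ifs <;> ring
    _ = χ (-1) * (Fintype.card R : ℂ) := by
        rw [sum_units_psiAnn_eq_zero ψ 𝔪 hloc hA hsq χ hprim, mul_zero, sub_zero, sum_ite_eq' univ (-1 : Rˣ)]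
        rw [if_pos (mem_univ _), Units.val_neg, Units.val_one]

end Summit.Ventures.HodgeRepro.GaussSumStability

end
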